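import Summits.AnomalousDissipation.AnomalousDissipation.Theorems.SolenoidalFractalHomogenisationRealisedQuasiStaticCellLawSlavedLadderFast
import HarnessLib

/-!
# K2R `RealisedQuasiStaticCellLaw`, line `floquet-bloch`, stub `stub_lowSectorDecay` (S1D): the slaved PAIR of ladders with
# a joint slow quadratic form, I — the exact slow fields and the slow form

Summits-side helper file (everything proved; no definitions, no named facts; `--supports stmt-AnomalousDissipation-20446`).
The slaving functional of `…SlavedLadder` gives each polarisation block of a principal coset its own (anisotropic) slaved
rate; the crux rate for the Taylor sectors `|ℓ′| = O(1)` is the ISOTROPIC slot sum, which no single polarisation realises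
slot by slot. Device (co-moving slow metric): measure the slow pair `y = (v¹₀, v²₀)` (out-of-plane / in-plane slow entries
of the two ladders of one coset, same `W, d, Λ, g`, links `s¹, s²`) in a time-dependent Hermitian form
`S = a|y₁|² + b|y₂|² + 2Re(c ȳ₁ y₂)` whose weights absorb the difference between the instantaneous nominal slaved rates
`λ_k = Λ(d₀ + g²σ_k)` and a CONSTANT target rate `λ̄`: `a' = 2(λ₁−λ̄)a`, `b' = 2(λ₂−λ̄)b`, `c' = (λ₁+λ₂−2λ̄)c`
(over a period this is `G(t) = e^{−2λ̄t} U(t)^{−*}U(t)^{−1}` for the nominal slow propagator `U`). Then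
`Φ = S + β(F¹ + F²)` (`F^k` the fast remainders of `…SlavedLadderFast`) obeys `Φ' ≤ −2((1−ε)λ̄ − μ₀)Φ`
(`slavedPair_pointwise`) when `16G_max² g_T² Λ γ² ≤ G_min ε λ̄ β Δ`, `g_T²·4γ²/Δ + 2λ̄/Λ ≤ Δ`, with the slack
`μ₀ = 4βγ²(Λg_T³σ + g_D + Λg_T²)²/(G_min ΛΔ³)` (`σ = max σ_k`, `G_min ≤ S/|y|²`, `a, b, |c| ≤ G_max`). The identity
`slow_field_eq` isolates the exact slaved slow field `Fv₀ = −λ_k x₀ − gΛX` with `‖X‖ ≤ γ√F`.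
-/

set_option linter.dupNamespace false

namespace Summit.AnomalousDissipation.AnomalousDissipation.Theorems.SolenoidalFractalHomogenisation.RealisedQuasiStaticCellLaw

noncomputable section

open Set Finset Complex
open scoped BigOperators ComplexConjugate

/-! ## §1 The exact slaved slow field of one ladder -/

/-- **The slaved slow field.** With `X = s₋₁(x₋₁ − hf₋₁x₀) − s₀(x₁ − hf₁x₀)`: `Fv₀ = −Λ(d₀ + g²σ)x₀ − gΛX` and
`‖X‖ ≤ γ√F`, `F = Σ_{J∈W∖0}‖x_J − hf_J x₀‖²`. -/
theorem slow_field_eq (W : Finset ℤ) (h1 : (1 : ℤ) ∈ W) (hm1 : (-1 : ℤ) ∈ W)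
    (d s : ℤ → ℝ) (Λ γ σ gt : ℝ) (x : ℤ → ℂ) (Fv0 : ℂ) (hf : ℤ → ℝ)
    (hγ : γ ^ 2 = s 0 ^ 2 + s (-1) ^ 2) (hγ0 : 0 ≤ γ)
    (hσ : σ = s (-1) ^ 2 / (d (-1) - d 0) + s 0 ^ 2 / (d 1 - d 0))
    (hFv0 : Fv0 = -(Λ : ℂ) * ((d 0 : ℂ) * x 0) -
      (gt : ℂ) * (Λ : ℂ) * ((s (0 - 1) : ℂ) * x (0 - 1) - (s 0 : ℂ) * x (0 + 1)))
    (hhf : ∀ J, hf J = if J = 1 then -(gt * s 0 / (d 1 - d 0))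
      else if J = -1 then gt * s (-1) / (d (-1) - d 0) else 0) :
    Fv0 = -(((Λ * (d 0 + gt ^ 2 * σ)) : ℝ) : ℂ) * x 0 -
        ((gt * Λ : ℝ) : ℂ) * ((s (-1) : ℂ) * (x (-1) - (hf (-1) : ℂ) * x 0) - (s 0 : ℂ) * (x 1 - (hf 1 : ℂ) * x 0)) ∧
      ‖(s (-1) : ℂ) * (x (-1) - (hf (-1) : ℂ) * x 0) - (s 0 : ℂ) * (x 1 - (hf 1 : ℂ) * x 0)‖ ≤
        γ * Real.sqrt (∑ J ∈ W.erase 0, ‖x J - (hf J : ℂ) * x 0‖ ^ 2) := by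
  classical
  have h1W' : (1 : ℤ) ∈ W.erase 0 := Finset.mem_erase.2 ⟨by norm_num, h1⟩
  have hm1W' : (-1 : ℤ) ∈ W.erase 0 := Finset.mem_erase.2 ⟨by norm_num, hm1⟩
  have hf1 : hf 1 = -(gt * s 0 / (d 1 - d 0)) := by rw [hhf]; simp
  have hfm1 : hf (-1) = gt * s (-1) / (d (-1) - d 0) := by rw [hhf]; norm_num
  refine ⟨?_, ?_⟩
  · have hslow_id : (s (-1) : ℂ) * x (-1) - (s 0 : ℂ) * x 1 =
        ((s (-1) : ℂ) * (x (-1) - (hf (-1) : ℂ) * x 0) - (s 0 : ℂ) * (x 1 - (hf 1 : ℂ) * x 0)) +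
          ((gt * σ : ℝ) : ℂ) * x 0 := by
      rw [hf1, hfm1, hσ]; push_cast; ring
    rw [hFv0]; norm_num; rw [hslow_id]; push_cast; ring
  · have h := norm_sub_two_le_sqrt (s (-1)) (s 0) (x (-1) - (hf (-1) : ℂ) * x 0) (x 1 - (hf 1 : ℂ) * x 0)
    have e : Real.sqrt (s (-1) ^ 2 + s 0 ^ 2) = γ := by rw [← Real.sqrt_sq hγ0, hγ, add_comm]
    rw [e] at h
    refine h.trans (mul_le_mul_of_nonneg_left (Real.sqrt_le_sqrt ?_) hγ0)
    have hsub : ({-1, 1} : Finset ℤ) ⊆ W.erase 0 := by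
      intro J hJ
      simp only [Finset.mem_insert, Finset.mem_singleton] at hJ
      rcases hJ with rfl | rfl
      · exact hm1W'
      · exact h1W'
    have := Finset.sum_le_sum_of_subset_of_nonneg hsub (fun J _ _ => sq_nonneg ‖x J - (hf J : ℂ) * x 0‖)
    rw [Finset.sum_pair (by norm_num)] at this
    exact this

/-! ## §2 The slow form -/

/-- **The slow form of the slaved pair.** With weights `a, b, c` (`a, b, |c| ≤ G_max`, `a, b ≥ 0`) and the exact
slaved slow fields `Fv_k₀ = −λ_k x_k₀ − gΛX_k` (`slow_field_eq`), the weighted derivative of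
`S = a|x₁₀|² + b|x₂₀|² + 2Re(c x̄₁₀ x₂₀)` is `−2λ̄S` plus a forcing of size at most
`4|g|ΛG_max γ (|x₁₀| + |x₂₀|)(√F₁ + √F₂)`. -/
theorem slavedPair_slow_le (W : Finset ℤ) (h1 : (1 : ℤ) ∈ W) (hm1 : (-1 : ℤ) ∈ W)
    (d s₁ s₂ : ℤ → ℝ) (Λ γ σ₁ σ₂ gt lam Gmax a b : ℝ) (c : ℂ)
    (x₁ x₂ : ℤ → ℂ) (Fv₁0 Fv₂0 : ℂ) (hf₁ hf₂ : ℤ → ℝ)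
    (hγ₁ : s₁ 0 ^ 2 + s₁ (-1) ^ 2 ≤ γ ^ 2) (hγ₂ : s₂ 0 ^ 2 + s₂ (-1) ^ 2 ≤ γ ^ 2) (hγ0 : 0 ≤ γ)
    (hσ₁ : σ₁ = s₁ (-1) ^ 2 / (d (-1) - d 0) + s₁ 0 ^ 2 / (d 1 - d 0))
    (hσ₂ : σ₂ = s₂ (-1) ^ 2 / (d (-1) - d 0) + s₂ 0 ^ 2 / (d 1 - d 0))
    (hΛ : 0 < Λ) (ha0 : 0 ≤ a) (hb0 : 0 ≤ b) (hGmax : a ≤ Gmax ∧ b ≤ Gmax ∧ ‖c‖ ≤ Gmax)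
    (hFv₁0 : Fv₁0 = -(Λ : ℂ) * ((d 0 : ℂ) * x₁ 0) -
      (gt : ℂ) * (Λ : ℂ) * ((s₁ (0 - 1) : ℂ) * x₁ (0 - 1) - (s₁ 0 : ℂ) * x₁ (0 + 1)))
    (hFv₂0 : Fv₂0 = -(Λ : ℂ) * ((d 0 : ℂ) * x₂ 0) -
      (gt : ℂ) * (Λ : ℂ) * ((s₂ (0 - 1) : ℂ) * x₂ (0 - 1) - (s₂ 0 : ℂ) * x₂ (0 + 1)))
    (hhf₁ : ∀ J, hf₁ J = if J = 1 then -(gt * s₁ 0 / (d 1 - d 0))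
      else if J = -1 then gt * s₁ (-1) / (d (-1) - d 0) else 0)
    (hhf₂ : ∀ J, hf₂ J = if J = 1 then -(gt * s₂ 0 / (d 1 - d 0))
      else if J = -1 then gt * s₂ (-1) / (d (-1) - d 0) else 0) :
    (2 * (Λ * (d 0 + gt ^ 2 * σ₁) - lam) * a) * ‖x₁ 0‖ ^ 2 + (2 * (Λ * (d 0 + gt ^ 2 * σ₂) - lam) * b) * ‖x₂ 0‖ ^ 2 +
        2 * ((((Λ * (d 0 + gt ^ 2 * σ₁) + Λ * (d 0 + gt ^ 2 * σ₂) - 2 * lam : ℝ) : ℂ) * c) * conj (x₁ 0) * x₂ 0).re +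
      (a * (2 * (Fv₁0 * conj (x₁ 0)).re) + b * (2 * (Fv₂0 * conj (x₂ 0)).re) +
        2 * (c * conj Fv₁0 * x₂ 0 + c * conj (x₁ 0) * Fv₂0).re) ≤
      -2 * lam * (a * ‖x₁ 0‖ ^ 2 + b * ‖x₂ 0‖ ^ 2 + 2 * (c * conj (x₁ 0) * x₂ 0).re) +
        4 * |gt| * Λ * Gmax * γ * ((‖x₁ 0‖ + ‖x₂ 0‖) *
          (Real.sqrt (∑ J ∈ W.erase 0, ‖x₁ J - (hf₁ J : ℂ) * x₁ 0‖ ^ 2) +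
            Real.sqrt (∑ J ∈ W.erase 0, ‖x₂ J - (hf₂ J : ℂ) * x₂ 0‖ ^ 2))) := by
  classical
  obtain ⟨hGa, hGb, hGc⟩ := hGmax
  have hGmax0 : 0 ≤ Gmax := (norm_nonneg c).trans hGc
  -- per-ladder `γ_k`
  obtain ⟨γ₁, hγ₁def⟩ : ∃ γ₁ : ℝ, γ₁ = Real.sqrt (s₁ 0 ^ 2 + s₁ (-1) ^ 2) := ⟨_, rfl⟩
  obtain ⟨γ₂, hγ₂def⟩ : ∃ γ₂ : ℝ, γ₂ = Real.sqrt (s₂ 0 ^ 2 + s₂ (-1) ^ 2) := ⟨_, rfl⟩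
  have hγ₁sq : γ₁ ^ 2 = s₁ 0 ^ 2 + s₁ (-1) ^ 2 := by rw [hγ₁def]; exact Real.sq_sqrt (by positivity)
  have hγ₂sq : γ₂ ^ 2 = s₂ 0 ^ 2 + s₂ (-1) ^ 2 := by rw [hγ₂def]; exact Real.sq_sqrt (by positivity)
  have hγ₁0 : 0 ≤ γ₁ := by rw [hγ₁def]; exact Real.sqrt_nonneg _
  have hγ₂0 : 0 ≤ γ₂ := by rw [hγ₂def]; exact Real.sqrt_nonneg _
  have hγ₁le : γ₁ ≤ γ := by rw [hγ₁def, ← Real.sqrt_sq hγ0]; exact Real.sqrt_le_sqrt hγ₁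
  have hγ₂le : γ₂ ≤ γ := by rw [hγ₂def, ← Real.sqrt_sq hγ0]; exact Real.sqrt_le_sqrt hγ₂
  -- energies and sizes
  obtain ⟨F₁, hF₁def⟩ : ∃ F : ℝ, F = ∑ J ∈ W.erase 0, ‖x₁ J - (hf₁ J : ℂ) * x₁ 0‖ ^ 2 := ⟨_, rfl⟩
  obtain ⟨F₂, hF₂def⟩ : ∃ F : ℝ, F = ∑ J ∈ W.erase 0, ‖x₂ J - (hf₂ J : ℂ) * x₂ 0‖ ^ 2 := ⟨_, rfl⟩
  have hF₁0 : 0 ≤ F₁ := by rw [hF₁def]; exact Finset.sum_nonneg fun J _ => by positivity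
  have hF₂0 : 0 ≤ F₂ := by rw [hF₂def]; exact Finset.sum_nonneg fun J _ => by positivity
  obtain ⟨Y₁, hY₁def⟩ : ∃ Y : ℝ, Y = Real.sqrt F₁ := ⟨_, rfl⟩
  obtain ⟨Y₂, hY₂def⟩ : ∃ Y : ℝ, Y = Real.sqrt F₂ := ⟨_, rfl⟩
  have hY₁0 : 0 ≤ Y₁ := by rw [hY₁def]; exact Real.sqrt_nonneg _
  have hY₂0 : 0 ≤ Y₂ := by rw [hY₂def]; exact Real.sqrt_nonneg _
  have hY₁sq : Y₁ ^ 2 = F₁ := by rw [hY₁def]; exact Real.sq_sqrt hF₁0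
  have hY₂sq : Y₂ ^ 2 = F₂ := by rw [hY₂def]; exact Real.sq_sqrt hF₂0
  obtain ⟨V₁, hV₁def⟩ : ∃ V : ℝ, V = ‖x₁ 0‖ := ⟨_, rfl⟩
  obtain ⟨V₂, hV₂def⟩ : ∃ V : ℝ, V = ‖x₂ 0‖ := ⟨_, rfl⟩
  have hV₁0 : 0 ≤ V₁ := by rw [hV₁def]; exact norm_nonneg _
  have hV₂0 : 0 ≤ V₂ := by rw [hV₂def]; exact norm_nonneg _
  obtain ⟨S, hSdef⟩ : ∃ S : ℝ, S = a * ‖x₁ 0‖ ^ 2 + b * ‖x₂ 0‖ ^ 2 + 2 * (c * conj (x₁ 0) * x₂ 0).re := ⟨_, rfl⟩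
  -- the slow fields
  obtain ⟨hFv₁0, hX₁⟩ := slow_field_eq W h1 hm1 d s₁ Λ γ₁ σ₁ gt x₁ Fv₁0 hf₁ hγ₁sq hγ₁0 hσ₁ hFv₁0 hhf₁
  obtain ⟨hFv₂0, hX₂⟩ := slow_field_eq W h1 hm1 d s₂ Λ γ₂ σ₂ gt x₂ Fv₂0 hf₂ hγ₂sq hγ₂0 hσ₂ hFv₂0 hhf₂
  obtain ⟨X₁, hX₁def⟩ : ∃ X : ℂ, X = (s₁ (-1) : ℂ) * (x₁ (-1) - (hf₁ (-1) : ℂ) * x₁ 0) -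
      (s₁ 0 : ℂ) * (x₁ 1 - (hf₁ 1 : ℂ) * x₁ 0) := ⟨_, rfl⟩
  obtain ⟨X₂, hX₂def⟩ : ∃ X : ℂ, X = (s₂ (-1) : ℂ) * (x₂ (-1) - (hf₂ (-1) : ℂ) * x₂ 0) -
      (s₂ 0 : ℂ) * (x₂ 1 - (hf₂ 1 : ℂ) * x₂ 0) := ⟨_, rfl⟩
  rw [← hX₁def] at hFv₁0 hX₁
  rw [← hX₂def] at hFv₂0 hX₂
  rw [← hF₁def, ← hY₁def] at hX₁
  rw [← hF₂def, ← hY₂def] at hX₂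
  have hX₁' : ‖X₁‖ ≤ γ * Y₁ := hX₁.trans (mul_le_mul_of_nonneg_right hγ₁le hY₁0)
  have hX₂' : ‖X₂‖ ≤ γ * Y₂ := hX₂.trans (mul_le_mul_of_nonneg_right hγ₂le hY₂0)
  ------------------------------------------------------------------
  -- (A) the slow form: `S' = -2 lam S + forcing`, `|forcing| ≤ 4 |gt| Λ Gmax γ (V₁+V₂)(Y₁+Y₂)`
  ------------------------------------------------------------------
  have habs : ∀ z w : ℂ, |(z * w).re| ≤ ‖z‖ * ‖w‖ := fun z w =>
    (Complex.abs_re_le_norm _).trans (le_of_eq (norm_mul _ _))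
  have hslow : (2 * (Λ * (d 0 + gt ^ 2 * σ₁) - lam) * a) * ‖x₁ 0‖ ^ 2 +
        (2 * (Λ * (d 0 + gt ^ 2 * σ₂) - lam) * b) * ‖x₂ 0‖ ^ 2 +
        2 * ((((Λ * (d 0 + gt ^ 2 * σ₁) + Λ * (d 0 + gt ^ 2 * σ₂) - 2 * lam : ℝ) : ℂ) * c) * conj (x₁ 0) * x₂ 0).re +
      (a * (2 * (Fv₁0 * conj (x₁ 0)).re) + b * (2 * (Fv₂0 * conj (x₂ 0)).re) +
        2 * (c * conj (Fv₁0) * x₂ 0 + c * conj (x₁ 0) * Fv₂0).re) ≤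
      -2 * lam * S + 4 * |gt| * Λ * Gmax * γ * ((V₁ + V₂) * (Y₁ + Y₂)) := by
    -- exact identity: the nominal rates cancel, leaving `-2 lam S` and the `X`-forcing
    have e : (2 * (Λ * (d 0 + gt ^ 2 * σ₁) - lam) * a) * ‖x₁ 0‖ ^ 2 +
        (2 * (Λ * (d 0 + gt ^ 2 * σ₂) - lam) * b) * ‖x₂ 0‖ ^ 2 +
        2 * ((((Λ * (d 0 + gt ^ 2 * σ₁) + Λ * (d 0 + gt ^ 2 * σ₂) - 2 * lam : ℝ) : ℂ) * c) * conj (x₁ 0) * x₂ 0).re +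
      (a * (2 * (Fv₁0 * conj (x₁ 0)).re) + b * (2 * (Fv₂0 * conj (x₂ 0)).re) +
        2 * (c * conj (Fv₁0) * x₂ 0 + c * conj (x₁ 0) * Fv₂0).re) =
      -2 * lam * S + (-(2 * a * (gt * Λ)) * (X₁ * conj (x₁ 0)).re + -(2 * b * (gt * Λ)) * (X₂ * conj (x₂ 0)).re +
        -(2 * (gt * Λ)) * (c * conj X₁ * x₂ 0 + c * conj (x₁ 0) * X₂).re) := by
      rw [hSdef, hFv₁0, hFv₂0]
      have r1 : ∀ z : ℂ, (z).re = z.re := fun z => rfl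
      simp only [map_sub, map_mul, map_neg, Complex.conj_ofReal]
      have n1 : (x₁ 0 * conj (x₁ 0)) = ((‖x₁ 0‖ ^ 2 : ℝ) : ℂ) := by rw [Complex.mul_conj']; push_cast; ring
      have n2 : (x₂ 0 * conj (x₂ 0)) = ((‖x₂ 0‖ ^ 2 : ℝ) : ℂ) := by rw [Complex.mul_conj']; push_cast; ring
      -- expand real parts
      have E1 : (( -(((Λ * (d 0 + gt ^ 2 * σ₁)) : ℝ) : ℂ) * x₁ 0 - ((gt * Λ : ℝ) : ℂ) * X₁) * conj (x₁ 0)).re =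
          -(Λ * (d 0 + gt ^ 2 * σ₁)) * ‖x₁ 0‖ ^ 2 - gt * Λ * (X₁ * conj (x₁ 0)).re := by
        have : ( -(((Λ * (d 0 + gt ^ 2 * σ₁)) : ℝ) : ℂ) * x₁ 0 - ((gt * Λ : ℝ) : ℂ) * X₁) * conj (x₁ 0) =
            -((((Λ * (d 0 + gt ^ 2 * σ₁)) : ℝ) : ℂ) * (x₁ 0 * conj (x₁ 0))) - ((gt * Λ : ℝ) : ℂ) * (X₁ * conj (x₁ 0)) := by
          ring
        rw [this, n1, Complex.sub_re, Complex.neg_re, ← Complex.ofReal_mul, Complex.ofReal_re, Complex.re_ofReal_mul]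
        ring
      have E2 : (( -(((Λ * (d 0 + gt ^ 2 * σ₂)) : ℝ) : ℂ) * x₂ 0 - ((gt * Λ : ℝ) : ℂ) * X₂) * conj (x₂ 0)).re =
          -(Λ * (d 0 + gt ^ 2 * σ₂)) * ‖x₂ 0‖ ^ 2 - gt * Λ * (X₂ * conj (x₂ 0)).re := by
        have : ( -(((Λ * (d 0 + gt ^ 2 * σ₂)) : ℝ) : ℂ) * x₂ 0 - ((gt * Λ : ℝ) : ℂ) * X₂) * conj (x₂ 0) =
            -((((Λ * (d 0 + gt ^ 2 * σ₂)) : ℝ) : ℂ) * (x₂ 0 * conj (x₂ 0))) - ((gt * Λ : ℝ) : ℂ) * (X₂ * conj (x₂ 0)) := by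
          ring
        rw [this, n2, Complex.sub_re, Complex.neg_re, ← Complex.ofReal_mul, Complex.ofReal_re, Complex.re_ofReal_mul]
        ring
      have E3 : (c * (-(((Λ * (d 0 + gt ^ 2 * σ₁) : ℝ)) : ℂ) * conj (x₁ 0) - ((gt * Λ : ℝ) : ℂ) * conj X₁) * x₂ 0 +
            c * conj (x₁ 0) * (-(((Λ * (d 0 + gt ^ 2 * σ₂)) : ℝ) : ℂ) * x₂ 0 - ((gt * Λ : ℝ) : ℂ) * X₂)).re =
          -(Λ * (d 0 + gt ^ 2 * σ₁) + Λ * (d 0 + gt ^ 2 * σ₂)) * (c * conj (x₁ 0) * x₂ 0).re -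
            gt * Λ * (c * conj X₁ * x₂ 0 + c * conj (x₁ 0) * X₂).re := by
        have : c * (-(((Λ * (d 0 + gt ^ 2 * σ₁) : ℝ)) : ℂ) * conj (x₁ 0) - ((gt * Λ : ℝ) : ℂ) * conj X₁) * x₂ 0 +
            c * conj (x₁ 0) * (-(((Λ * (d 0 + gt ^ 2 * σ₂)) : ℝ) : ℂ) * x₂ 0 - ((gt * Λ : ℝ) : ℂ) * X₂) =
            -((((Λ * (d 0 + gt ^ 2 * σ₁) + Λ * (d 0 + gt ^ 2 * σ₂)) : ℝ) : ℂ) * (c * conj (x₁ 0) * x₂ 0)) -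
              ((gt * Λ : ℝ) : ℂ) * (c * conj X₁ * x₂ 0 + c * conj (x₁ 0) * X₂) := by
          push_cast; ring
        rw [this, Complex.sub_re, Complex.neg_re, Complex.re_ofReal_mul, Complex.re_ofReal_mul]
        ring
      have E4 : ((((Λ * (d 0 + gt ^ 2 * σ₁) + Λ * (d 0 + gt ^ 2 * σ₂) - 2 * lam : ℝ) : ℂ) * c) * conj (x₁ 0) * x₂ 0).re =
          (Λ * (d 0 + gt ^ 2 * σ₁) + Λ * (d 0 + gt ^ 2 * σ₂) - 2 * lam) * (c * conj (x₁ 0) * x₂ 0).re := by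
        have : (((Λ * (d 0 + gt ^ 2 * σ₁) + Λ * (d 0 + gt ^ 2 * σ₂) - 2 * lam : ℝ) : ℂ) * c) * conj (x₁ 0) * x₂ 0 =
            ((Λ * (d 0 + gt ^ 2 * σ₁) + Λ * (d 0 + gt ^ 2 * σ₂) - 2 * lam : ℝ) : ℂ) * (c * conj (x₁ 0) * x₂ 0) := by ring
        rw [this, Complex.re_ofReal_mul]
      rw [E1, E2, E3, E4]
      ring
    rw [e]
    -- bound the forcing
    have b1 : |(X₁ * conj (x₁ 0)).re| ≤ γ * Y₁ * V₁ := by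
      refine (habs _ _).trans ?_
      rw [Complex.norm_conj, ← hV₁def]
      exact mul_le_mul_of_nonneg_right hX₁' hV₁0
    have b2 : |(X₂ * conj (x₂ 0)).re| ≤ γ * Y₂ * V₂ := by
      refine (habs _ _).trans ?_
      rw [Complex.norm_conj, ← hV₂def]
      exact mul_le_mul_of_nonneg_right hX₂' hV₂0
    have b3 : |(c * conj X₁ * x₂ 0 + c * conj (x₁ 0) * X₂).re| ≤ Gmax * (γ * Y₁ * V₂ + V₁ * (γ * Y₂)) := by
      refine (Complex.abs_re_le_norm _).trans ((norm_add_le _ _).trans ?_)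
      rw [norm_mul, norm_mul, norm_mul, norm_mul, Complex.norm_conj, Complex.norm_conj, ← hV₁def, ← hV₂def]
      have t1 : ‖c‖ * ‖X₁‖ * V₂ ≤ Gmax * (γ * Y₁) * V₂ :=
        mul_le_mul_of_nonneg_right (mul_le_mul hGc hX₁' (norm_nonneg _) hGmax0) hV₂0
      have t2 : ‖c‖ * V₁ * ‖X₂‖ ≤ Gmax * V₁ * (γ * Y₂) :=
        mul_le_mul (mul_le_mul_of_nonneg_right hGc hV₁0) hX₂' (norm_nonneg _) (by positivity)
      linarith only [t1, t2]
    have hgΛ : 0 ≤ |gt| * Λ := by positivity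
    have c1 : -(2 * a * (gt * Λ)) * (X₁ * conj (x₁ 0)).re ≤ 2 * Gmax * (|gt| * Λ) * (γ * Y₁ * V₁) := by
      have t : |(2 * a * (gt * Λ)) * (X₁ * conj (x₁ 0)).re| ≤ 2 * Gmax * (|gt| * Λ) * (γ * Y₁ * V₁) := by
        rw [abs_mul, abs_mul, abs_mul, abs_mul, abs_two, abs_of_nonneg ha0, abs_of_pos hΛ]
        gcongr
      have := neg_abs_le ((2 * a * (gt * Λ)) * (X₁ * conj (x₁ 0)).re)
      rw [neg_mul]; linarith only [t, this]
    have c2 : -(2 * b * (gt * Λ)) * (X₂ * conj (x₂ 0)).re ≤ 2 * Gmax * (|gt| * Λ) * (γ * Y₂ * V₂) := by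
      have t : |(2 * b * (gt * Λ)) * (X₂ * conj (x₂ 0)).re| ≤ 2 * Gmax * (|gt| * Λ) * (γ * Y₂ * V₂) := by
        rw [abs_mul, abs_mul, abs_mul, abs_mul, abs_two, abs_of_nonneg hb0, abs_of_pos hΛ]
        gcongr
      have := neg_abs_le ((2 * b * (gt * Λ)) * (X₂ * conj (x₂ 0)).re)
      rw [neg_mul]; linarith only [t, this]
    have c3 : -(2 * (gt * Λ)) * (c * conj X₁ * x₂ 0 + c * conj (x₁ 0) * X₂).re ≤
        2 * (|gt| * Λ) * (Gmax * (γ * Y₁ * V₂ + V₁ * (γ * Y₂))) := by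
      have t : |(2 * (gt * Λ)) * (c * conj X₁ * x₂ 0 + c * conj (x₁ 0) * X₂).re| ≤
          2 * (|gt| * Λ) * (Gmax * (γ * Y₁ * V₂ + V₁ * (γ * Y₂))) := by
        rw [abs_mul, abs_mul, abs_mul, abs_of_pos hΛ, abs_two]
        exact mul_le_mul_of_nonneg_left b3 (by positivity)
      have := neg_abs_le ((2 * (gt * Λ)) * (c * conj X₁ * x₂ 0 + c * conj (x₁ 0) * X₂).re)
      rw [neg_mul]; linarith only [t, this]
    have hsum : 2 * Gmax * (|gt| * Λ) * (γ * Y₁ * V₁) + 2 * Gmax * (|gt| * Λ) * (γ * Y₂ * V₂) +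
        2 * (|gt| * Λ) * (Gmax * (γ * Y₁ * V₂ + V₁ * (γ * Y₂))) = 2 * |gt| * Λ * Gmax * γ * ((V₁ + V₂) * (Y₁ + Y₂)) := by
      ring
    have hext : 2 * |gt| * Λ * Gmax * γ * ((V₁ + V₂) * (Y₁ + Y₂)) ≤ 4 * |gt| * Λ * Gmax * γ * ((V₁ + V₂) * (Y₁ + Y₂)) := by
      have : 0 ≤ |gt| * Λ * Gmax * γ * ((V₁ + V₂) * (Y₁ + Y₂)) := by positivity
      linarith only [this]
    linarith only [c1, c2, c3, hsum, hext]
  ------------------------------------------------------------------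
  rw [← hSdef, ← hF₁def, ← hF₂def, ← hY₁def, ← hY₂def, ← hV₁def, ← hV₂def]
  rw [← hV₁def, ← hV₂def] at hslow
  exact hslow

end

end Summit.AnomalousDissipation.AnomalousDissipation.Theorems.SolenoidalFractalHomogenisation.RealisedQuasiStaticCellLaw
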